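import Summits.CriticalPhenomena.PercolationContinuityZ3.Theorems.Transplant.FKConnectivityAllQCountReweightedFKG
import Literature.Probability.Percolation.FoldingFibres
import HarnessLib

/-!
# UNIFORM-RELAY LEVELWISE GLUING: one statement about Bernoulli percolation that gives Kozma–Nitzan's additive gluing under
# EVERY cluster-count reweighting `μ_h ∝ P_w·h(k)` — the node `UniformLevelGluingPos` and the reduction to `AdditiveGluingCountPos`

Support file (`--supports stmt-CriticalPhenomena-4575`), FK sub-lane `prim-bschramm-fk-1` (gen 11) of the post-continuity programme;
builds on p205010 (kernel theorem, internal audit signed; external expert review pending).  Definitions (`levelSet`,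
`UniformLevelGluingOn`, the `@[conjecture]` node `UniformLevelGluingPos` — NOT asserted), no named facts, no sorries; standard axioms.
Nothing here bears on p205010: its chain proves additive gluing for PRODUCT measure; this file is about which other measures inherit it.

THE QUESTION (coordinator, 2026-08-20: 'for which class of measures do the finite links of the chain hold?').  The censuses of fk-1
g9/g10 and ttrl cp-hp5 found that additive gluing `μ(o ↔ b) ≥ μ(o ↔ A) − max_a μ(a ↮ b)` holds under EVERY count weight `h ≥ 0`
(`AdditiveGluingCountPos`: log-convex, log-concave, non-monotone, parity, one-level `h`; n ≤ 6, |A| ≤ 4; 0 violations), whereas every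
product-form intermediate of the Kozma–Nitzan route is FK-specific (hub ⟺ log-convex `h`, fk-1 g10; four-point ⟺ log-concave at the
6-cycle, fk-1 g11 `…CountReweightedFourPoint`).  This file isolates the statement behind the universality:

**(UL-AG) `UniformLevelGluingOn V`**: for every weight vector `w` on the pairs of `V`, source `o`, target `b` and non-empty relay set `A`,
writing `E = {o ↔ A} ∖ {o ↔ b}` (the gluing defect) and `L_j = {k(ω) = j}` (exactly `j` open clusters), THERE IS ONE RELAY `a* ∈ A` with
`P_w(E ∩ L_j) ≤ P_w({a* ↮ b} ∩ L_j)` FOR EVERY LEVEL `j` SIMULTANEOUSLY.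
(For a single level this is additive gluing for the level-conditioned percolation measure; the point is that the SAME relay serves all
levels.  Per-level failures of each individual relay are common — ≈ 8 % of placements at n = 5 — it is the existence of a level-uniform
relay that never failed.)  EVIDENCE (exact integer arithmetic, seat prover-prim-bschramm-fk-1-g11, work/numerics/ag_uniform.py, kit
j132384): n = 4 with a 7-value weight palette exhaustively (1,411,788 placements `(o,b,A)`), n = 5 random weighted `K_5` (264,000
placements, |A| ∈ {2,3}), n = 6 random weighted `K_6` (|A| ∈ {2,3,4}), sparse n = 7: 0 failures.  The selecting rule is NOT simply
'the relay least connected to `b`' (that rule picks a working relay in 414,011 of 414,190 discriminating cases).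
**`additiveGluingUnder_crMeasure_of_uniformLevel`**, **`additiveGluingCountPos_of_uniformLevelGluingPos`**: (UL-AG) ⇒ additive gluing
under `crMeasure w h` for every positive `h` — because `μ_h(X)·Z_h = Σ_j h(j)·P_w(X ∩ L_j)` (`crMeasure_real_mul_eq_sum_levels`), so the
levelwise domination sums to `μ_h(E) ≤ μ_h(a* ↮ b)`, and `{o ↔ A} ⊆ {o ↔ b} ∪ E`.  Hence (UL-AG) ⇒ `AdditiveGluingCountPos` ⇒
`FK.AdditiveGluingFKPos` (all `q > 0`); conversely, by a minimax argument (memo bschramm/FROM-fk-1-g11-FOURPOINT.md §4) 'additive gluing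
for every `h ≥ 0`' is equivalent to (UL-AG) with a MIXED relay (a probability vector on `A`), so the census tables of g9/g10 and this node
carry the same information; the pure form filed here is the stronger, cleaner one and is what the censuses actually verify.
`uniformLevelGluingOn_singleton`: for `|A| = 1` the statement is the union bound (sanity).
[cite: KozmaNitzan2024, Conj. 1 (p. 3); Thm. 1 (p. 7)] [cite: Grimmett2006, §1.4 eq. (1.20) (p. 15); §3.9 (pp. 63–65)]
-/

noncomputable section

namespace Summit.CriticalPhenomena.PercolationContinuityZ3.Theorems

namespace FK

open MeasureTheory Set Literature.Probability.LatticeModels Literature.Probability.Percolation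
open Literature.Probability.Percolation.BHK2006 (weight)
open Literature.Probability.Percolation.DecisionTree (ind ind_of_mem ind_of_not_mem ind_nonneg)
open scoped Classical

variable {V : Type*} [Fintype V]

/-! ### Levels of the cluster count -/

/-- **The level set `L_j = {ω : k(ω) = j}`** of configurations with exactly `j` open clusters (free count).
[cite: Grimmett2006, §1.2 eq. (1.1) (p. 4)] -/
def levelSet (V : Type*) [Fintype V] (j : ℕ) : Set (BondConfig V) := {ω | clusterCount ω ∅ = j}

omit [Fintype V] in
/-- Membership in a level set. [folklore] -/
theorem mem_levelSet_iff [Fintype V] (j : ℕ) (ω : BondConfig V) : ω ∈ levelSet V j ↔ clusterCount ω ∅ = j := Iff.rfl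

/-- The free cluster count is at most the number of vertices. [cite: Grimmett2006, §1.2 eq. (1.1) (p. 4)] -/
theorem clusterCount_empty_le_card (ω : BondConfig V) : clusterCount ω ∅ ≤ Fintype.card V := by
  unfold clusterCount
  rw [← Nat.card_eq_fintype_card]
  exact Nat.card_le_card_of_surjective _ (fun c => Quot.inductionOn c fun v => ⟨v, rfl⟩)

/-! ### The node -/

/-- **Uniform-relay levelwise gluing on the vertex type `V`** (UL-AG): for all weights `w`, every non-empty relay set `A`, source `o` and
target `b` there is ONE relay `a ∈ A` such that for EVERY level `j`,
`P_w(({o ↔ A} ∖ {o ↔ b}) ∩ L_j) ≤ P_w({a ↮ b} ∩ L_j)`. [cite: KozmaNitzan2024, Conj. 1 (p. 3)] [cite: Grimmett2006, §1.2 eq. (1.1) (p. 4)] -/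
def UniformLevelGluingOn (V : Type*) [Fintype V] : Prop :=
  ∀ (w : Sym2 V → unitInterval) (A : Finset V) (o b : V), A.Nonempty →
    ∃ a ∈ A, ∀ j : ℕ,
      (prodBernoulli w).real (((⋃ x ∈ A, openConn o x) \ openConn o b) ∩ levelSet V j) ≤
        (prodBernoulli w).real ((openConn a b)ᶜ ∩ levelSet V j)

/-- **Uniform-relay levelwise gluing on every finite weighted graph.**  CONJECTURE-SHAPED STATEMENT, NOT asserted.  Evidence (fk-1 g11,
2026-08-21, exact): n = 4 palette-exhaustive (1,411,788 placements), n = 5 (264,000), n = 6 (|A| ≤ 4) and sparse n = 7 (kit j132384): 0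
failures.  Implies additive gluing under every positive count weight (`additiveGluingCountPos_of_uniformLevelGluingPos`).
[cite: KozmaNitzan2024, Conj. 1 (p. 3); Thm. 1 (p. 7)] -/
@[conjecture] def UniformLevelGluingPos : Prop := ∀ n : ℕ, UniformLevelGluingOn (Fin n)

/-! ### Sanity: a single relay -/

omit [Fintype V] in
/-- The gluing defect of a single relay is contained in `{a ↮ b}`: `({o ↔ a} ∖ {o ↔ b}) ⊆ {a ↮ b}`. [cite: KozmaNitzan2024, p. 3 (|A| = 1)] -/
theorem diff_subset_compl_openConn (o a b : V) :
    ((openConn o a : Set (BondConfig V)) \ openConn o b) ⊆ (openConn a b)ᶜ := by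
  rintro ω ⟨hoa, hob⟩ hab
  exact hob (show (openGraph ω).Reachable o b from
    (show (openGraph ω).Reachable o a from hoa).trans (show (openGraph ω).Reachable a b from hab))

/-- **(UL-AG) for `|A| = 1` is the union bound** (every level, by monotonicity). [cite: KozmaNitzan2024, p. 3 (|A| = 1)] -/
theorem uniformLevelGluingOn_singleton (w : Sym2 V → unitInterval) (a o b : V) (j : ℕ) :
    (prodBernoulli w).real (((⋃ x ∈ ({a} : Finset V), openConn o x) \ openConn o b) ∩ levelSet V j) ≤
      (prodBernoulli w).real ((openConn a b)ᶜ ∩ levelSet V j) := by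
  refine measureReal_mono (fun ω hω => ⟨diff_subset_compl_openConn o a b ⟨?_, hω.1.2⟩, hω.2⟩)
  have h1 := hω.1.1
  simp only [Finset.mem_singleton, iUnion_iUnion_eq_left] at h1
  exact h1

/-! ### Level decomposition of a count-reweighted measure -/

/-- **`μ_{w,h}(X)·Z_h = Σ_{j ≤ |V|} h(j)·P_w(X ∩ L_j)`** — a count-reweighted mass is the `h`-weighted sum of the product-measure masses
of the level slices. [cite: Grimmett2006, §1.4 eq. (1.20) (p. 15)] -/
theorem crMeasure_real_mul_eq_sum_levels (w : Sym2 V → unitInterval) {h : ℕ → ℝ} (hpos : ∀ k, 0 < h k)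
    (X : Set (BondConfig V)) :
    (crMeasure w h).real X * crPartition w h =
      ∑ j ∈ Finset.range (Fintype.card V + 1), h j * (prodBernoulli w).real (X ∩ levelSet V j) := by
  have hZ := crPartition_pos w hpos
  rw [crMeasure_real_eq_sum_div w hpos X, div_mul_cancel₀ _ hZ.ne']
  simp_rw [prodBernoulli_real_eq_sum_weight_ind, Finset.mul_sum]
  rw [Finset.sum_comm]
  refine Finset.sum_congr rfl fun ω _ => ?_
  unfold crWeight
  -- only the level `j = k(ω)` contributes
  rw [Finset.sum_eq_single (clusterCount ω ∅)]
  · by_cases hX : ω ∈ X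
    · rw [ind_of_mem hX, ind_of_mem (show ω ∈ X ∩ levelSet V (clusterCount ω ∅) from ⟨hX, rfl⟩)]
      ring
    · rw [ind_of_not_mem hX, ind_of_not_mem (fun h' : ω ∈ X ∩ levelSet V (clusterCount ω ∅) => hX h'.1)]
      ring
  · intro j _ hj
    rw [ind_of_not_mem (fun h' : ω ∈ X ∩ levelSet V j => hj h'.2.symm), mul_zero, mul_zero]
  · intro hk
    exact absurd (Finset.mem_range.2 (Nat.lt_succ_of_le (clusterCount_empty_le_card ω))) hk

/-- **Levelwise domination sums to domination under every positive count weight**: if `P_w(X ∩ L_j) ≤ P_w(Y ∩ L_j)` for all `j`, then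
`μ_{w,h}(X) ≤ μ_{w,h}(Y)`. [cite: Grimmett2006, §1.4 eq. (1.20) (p. 15)] -/
theorem crMeasure_real_le_of_levels (w : Sym2 V → unitInterval) {h : ℕ → ℝ} (hpos : ∀ k, 0 < h k) {X Y : Set (BondConfig V)}
    (hle : ∀ j : ℕ, (prodBernoulli w).real (X ∩ levelSet V j) ≤ (prodBernoulli w).real (Y ∩ levelSet V j)) :
    (crMeasure w h).real X ≤ (crMeasure w h).real Y := by
  have hZ := crPartition_pos w hpos
  rw [← mul_le_mul_iff_of_pos_right hZ, crMeasure_real_mul_eq_sum_levels w hpos X, crMeasure_real_mul_eq_sum_levels w hpos Y]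
  exact Finset.sum_le_sum fun j _ => mul_le_mul_of_nonneg_left (hle j) (hpos j).le

/-! ### The reduction: (UL-AG) ⇒ additive gluing under every positive count weight -/

omit [Fintype V] in
/-- `{o ↔ A} ⊆ {o ↔ b} ∪ ({o ↔ A} ∖ {o ↔ b})`. [folklore] -/
theorem iUnion_subset_union_diff (A : Finset V) (o b : V) :
    (⋃ x ∈ A, (openConn o x : Set (BondConfig V))) ⊆ openConn o b ∪ ((⋃ x ∈ A, openConn o x) \ openConn o b) := by
  intro ω hω
  by_cases h : ω ∈ (openConn o b : Set (BondConfig V))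
  · exact Or.inl h
  · exact Or.inr ⟨hω, h⟩

/-- **Additive gluing under `μ_{w,h}` from uniform-relay levelwise gluing** (every positive `h`): take the relay `a*` of (UL-AG); then
`μ_h(E) ≤ μ_h(a* ↮ b) ≤ t` by `crMeasure_real_le_of_levels`, and `μ_h(o ↔ A) ≤ μ_h(o ↔ b) + μ_h(E)`.
[cite: KozmaNitzan2024, Conj. 1 (p. 3)] [cite: Grimmett2006, §1.4 eq. (1.20) (p. 15)] -/
theorem additiveGluingUnder_crMeasure_of_uniformLevel (hU : UniformLevelGluingOn V) (w : Sym2 V → unitInterval) {h : ℕ → ℝ}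
    (hpos : ∀ k, 0 < h k) (A : Finset V) (o b : V) : AdditiveGluingUnder (crMeasure w h) A o b := by
  haveI := isProbabilityMeasure_crMeasure w hpos
  intro t ht hA
  set μ := crMeasure w h with hμ
  set E : Set (BondConfig V) := (⋃ x ∈ A, openConn o x) \ openConn o b with hE
  have hunion : μ.real (⋃ x ∈ A, openConn o x) ≤ μ.real (openConn o b) + μ.real E :=
    (measureReal_mono (iUnion_subset_union_diff A o b)).trans (measureReal_union_le _ _)
  by_cases hne : A.Nonempty
  · obtain ⟨a, haA, hlev⟩ := hU w A o b hne
    have hEa : μ.real E ≤ μ.real (openConn a b)ᶜ := crMeasure_real_le_of_levels w hpos hlev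
    have hms : MeasurableSet (openConn a b : Set (BondConfig V)) := by
      haveI : Finite (Sym2 V) := inferInstance
      exact (Set.toFinite _).measurableSet
    have hcompl : μ.real (openConn a b)ᶜ = 1 - μ.real (openConn a b) := probReal_compl_eq_one_sub hms
    have hat := hA a haA
    linarith
  · rw [Finset.not_nonempty_iff_eq_empty] at hne
    subst hne
    have h0 : μ.real (⋃ x ∈ (∅ : Finset V), (openConn o x : Set (BondConfig V))) = 0 := by simp
    rw [h0]
    linarith [measureReal_nonneg (μ := μ) (s := openConn o b)]

/-- **`UniformLevelGluingPos → AdditiveGluingCountPos`**: uniform-relay levelwise gluing for Bernoulli percolation gives Kozma–Nitzan's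
additive gluing under every positive cluster-count reweighting (hence under every `φ_{w,q}`, `q > 0`, via `additiveGluingFKPos_of_countPos`).
[cite: KozmaNitzan2024, Conj. 1 (p. 3)] [cite: Grimmett2006, §3.9 (pp. 63–65)] -/
theorem additiveGluingCountPos_of_uniformLevelGluingPos (hU : UniformLevelGluingPos) : AdditiveGluingCountPos :=
  fun n w _ hpos A o b => additiveGluingUnder_crMeasure_of_uniformLevel (hU n) w hpos A o b

/-- **`UniformLevelGluingPos → FK.AdditiveGluingFKPos`** (all `q > 0`). [cite: KozmaNitzan2024, Conj. 1 (p. 3)] [cite: Grimmett2006, §3.9 (pp. 63–65)] -/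
theorem additiveGluingFKPos_of_uniformLevelGluingPos (hU : UniformLevelGluingPos) : AdditiveGluingFKPos :=
  additiveGluingFKPos_of_countPos (additiveGluingCountPos_of_uniformLevelGluingPos hU)

end FK

end Summit.CriticalPhenomena.PercolationContinuityZ3.Theorems

end
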